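import Summits.QuantumAdvantage.QuantumAdvantage.Theorems.PoolDichotomyA
import Summits.QuantumAdvantage.QuantumAdvantage.Theorems.StructuredEndA
import Summits.QuantumAdvantage.QuantumAdvantage.Theorems.JointFreenessLawC

set_option linter.dupNamespace false
set_option linter.unusedSectionVars false

/-!
# OneQuadDriverA (lens 4, g29; the (c0) DRIVER: register normal form + explicit parameters ⟹ loss, modulo `hBR`)

Blocker `X = AbsorptionDial.NoPerfectPolyOdd` (item 28487); decomp-qadv lens 4, g29.

The composition of the whole (c0) road (REFEREE-66v65 (P1)–(P9)) into ONE kernel theorem with only the REGISTER NORMAL FORM as structural input: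
registers `g ≠ g₀` are `k`-forms, `g₀ = H(labels Λu, quadVal M b u)`.  Inside: label preparation (`LabelPreparation.puncture_from`, `w₀ = w`),
the pool region `B₀ = U₀ᶜ`, kernel Y's greedy dichotomy `JointFreeness.free_dichotomy` for the single pencil member `M + Mᵀ` with weights on `B₀`:
* FREE `I` (`|I| = r`) ⟹ rows `e = I`, pool `B₀ ∖ I` (freeness survives at weight `w − r`, `free_sdiff`), side thresholds
  `E side = 4^{K₁} / (324·p^(2(r+k+1)))` (`side_threshold`) ⟹ `PoolDichotomyA.loss_of_Free_dichotomy` (mod `hBR`);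
* STRUCTURED ⟹ popular direction (`exists_popular_direction`), `structured_family`, a pair-free `f`-sub-pool (`JointFreenessLawC.exists_pairFree`,
  counting `pairFree_count`) ⟹ `StructuredEndA.loss_of_structuredPool`.
★ `loss_of_oneQuad_param`: the numeric side conditions are an explicit list of inequalities in `(n, p, k)` and the free parameters
`w w₂ r h L r₀ t N f t'` (all choosable polylogarithmic in `n` for `k = polylog n`; the asymptotic instantiation is a separate step).
Supports stmt-QuantumAdvantage-28487 (record; the residual `X` is NOT claimed).
-/

open Finset Module
open Summit.QuantumAdvantage.AdviceFreeQNC0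
open Summit.QuantumAdvantage.QuantumAdvantage.Theorems.InnerDegreeDial
open Summit.QuantumAdvantage.QuantumAdvantage.Theorems.LabelPreparation

namespace Summit.QuantumAdvantage.QuantumAdvantage.Theorems.ColumnBridge

section Helpers

variable {F : Type*} [Field F] {n t k : ℕ}

/-- freeness survives removing the free set from the weight region, at weight `w − |I|` -/
theorem free_sdiff (S : Fin t → Fin n → Fin n → F) (Λ : Fin k → Fin n → F) (B : Finset (Fin n)) (w : ℕ)
    (I : Finset (Fin n)) (h : JointFreeness.Free S Λ B w I) : JointFreeness.Free S Λ (B \ I) (w - I.card) I := by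
  classical
  intro a a' hsupp hne
  have hw := h a a' hsupp hne
  have hle : JointFreeness.wtOn B (JointFreeness.comb S Λ a a') ≤
      JointFreeness.wtOn (B \ I) (JointFreeness.comb S Λ a a') + I.card := by
    unfold JointFreeness.wtOn
    calc (B.filter fun l => JointFreeness.comb S Λ a a' l ≠ 0).card
        ≤ (((B \ I).filter fun l => JointFreeness.comb S Λ a a' l ≠ 0) ∪ I).card := by
          refine card_le_card fun l hl => ?_
          rw [mem_filter] at hl
          rw [mem_union, mem_filter, mem_sdiff]
          by_cases hlI : l ∈ I
          · exact Or.inr hlI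
          · exact Or.inl ⟨⟨hl.1, hlI⟩, hl.2⟩
      _ ≤ ((B \ I).filter fun l => JointFreeness.comb S Λ a a' l ≠ 0).card + I.card := card_union_le _ _
  omega

/-- a sum of a function supported in `I` is the sum over the enumeration of `I` -/
theorem sum_of_suppIn {β : Type*} [AddCommMonoid β] (g : Fin n → β) (I : Finset (Fin n)) {r₁ : ℕ} (h : I.card = r₁)
    (hg : ∀ i, i ∉ I → g i = 0) : ∑ i, g i = ∑ x : Fin r₁, g (I.orderEmbOfFin h x) := by
  calc ∑ i, g i = ∑ i ∈ I, g i := (sum_subset (subset_univ I) fun i _ hi => hg i hi).symm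
    _ = ∑ i ∈ univ.map (I.orderEmbOfFin h).toEmbedding, g i := by rw [map_orderEmbOfFin_univ]
    _ = ∑ x : Fin r₁, g (I.orderEmbOfFin h x) := sum_map _ _ _

/-- the side threshold arithmetic: with `E = x / D`, `2D ≤ x` and `4·D·Q ≤ P`: `D·E ≤ x`, `0 < E`, `2·Q·x ≤ E·P` -/
theorem side_threshold {x D Q P : ℕ} (hD : 0 < D) (hx : 2 * D ≤ x) (hP : 4 * D * Q ≤ P) :
    D * (x / D) ≤ x ∧ 0 < x / D ∧ 2 * Q * x ≤ x / D * P := by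
  have hE : 0 < x / D := Nat.div_pos (by omega) hD
  refine ⟨Nat.mul_div_le x D, hE, ?_⟩
  have hlt : x < x / D * D + D := Nat.lt_div_mul_add hD
  have hDE : D ≤ x / D * D := Nat.le_mul_of_pos_left D hE
  have hx2 : x ≤ 2 * D * (x / D) := by nlinarith
  calc 2 * Q * x ≤ 2 * Q * (2 * D * (x / D)) := Nat.mul_le_mul_left _ hx2
    _ = x / D * (4 * D * Q) := by ring
    _ ≤ x / D * P := Nat.mul_le_mul_left _ hP

/-- the first-moment count for a pair-free `f`-subset: `bad ≤ n'(w−1)` bad pairs and `w·f² + 2 ≤ n'` points suffice -/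
theorem pairFree_count {n' f w bad : ℕ} (h2f : 2 ≤ f) (hfn : f ≤ n') (hbad : bad ≤ n' * (w - 1))
    (hN : w * (f * f) + 2 ≤ n') : bad * (n' - 2).choose (f - 2) < n'.choose f := by
  have key := Nat.choose_mul (n := n') (k := f) (s := 2) h2f
  have hpos : 0 < (n' - 2).choose (f - 2) := Nat.choose_pos (by omega)
  have hcf : 0 < f.choose 2 := Nat.choose_pos h2f
  have h2c : ∀ m : ℕ, 2 * m.choose 2 = m * (m - 1) := fun m => by
    rw [Nat.choose_two_right, Nat.two_mul_div_two_of_even (Nat.even_mul_pred_self m)]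
  have hf2 := h2c f
  have hn2 := h2c n'
  -- bad · C(f,2) < C(n',2)
  have hmain : bad * f.choose 2 < n'.choose 2 := by
    have h1 : (w - 1) * (f * (f - 1)) ≤ w * (f * f) :=
      Nat.mul_le_mul (Nat.sub_le _ _) (Nat.mul_le_mul_left _ (Nat.sub_le _ _))
    have h2 : bad * (f * (f - 1)) ≤ n' * (n' - 2) :=
      calc bad * (f * (f - 1)) ≤ n' * (w - 1) * (f * (f - 1)) := Nat.mul_le_mul_right _ hbad
        _ = n' * ((w - 1) * (f * (f - 1))) := by ring
        _ ≤ n' * (w * (f * f)) := Nat.mul_le_mul_left _ h1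
        _ ≤ n' * (n' - 2) := Nat.mul_le_mul_left _ (by omega)
    have h3 : n' * (n' - 2) < n' * (n' - 1) := Nat.mul_lt_mul_of_pos_left (by omega) (by omega)
    have h4 : 2 * (bad * f.choose 2) < 2 * n'.choose 2 := by
      calc 2 * (bad * f.choose 2) = bad * (2 * f.choose 2) := by ring
        _ = bad * (f * (f - 1)) := by rw [hf2]
        _ < n' * (n' - 1) := lt_of_le_of_lt h2 h3
        _ = 2 * n'.choose 2 := hn2.symm
    omega
  have h5 : bad * (n' - 2).choose (f - 2) * f.choose 2 < n'.choose f * f.choose 2 := by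
    rw [key]
    calc bad * (n' - 2).choose (f - 2) * f.choose 2 = bad * f.choose 2 * (n' - 2).choose (f - 2) := by ring
      _ < n'.choose 2 * (n' - 2).choose (f - 2) := Nat.mul_lt_mul_of_pos_right hmain hpos
  exact Nat.lt_of_mul_lt_mul_right h5

end Helpers

variable {p : ℕ} [Fact p.Prime] {n : ℕ}
set_option maxHeartbeats 400000 in
/-- **THE (c0) DRIVER (kernel, modulo `hBR`).**  Register normal form — registers `g ≠ g₀` are `k`-forms, `g₀ = H(labels, quadVal M b)` —
plus an explicit list of numeric side conditions on the free parameters ⟹ some ring word is lost. -/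
theorem loss_of_oneQuad_param (hp5 : 5 ≤ p) (hp3 : p.Coprime 3) {k : ℕ} (c : ℕ)
    (y : Fin (n + 1) → (Fin n → Bool) → Bool) (g₀ : Fin (n + 1))
    (lam : Fin (n + 1) → Fin k → Fin n → ZMod p) (F : Fin (n + 1) → (Fin k → ZMod p) → Bool)
    (hF : ∀ g, g ≠ g₀ → ∀ u, y g u = F g (fun j => ∑ i, if u i = true then lam g j i else 0))
    (Λ : Fin k → Fin n → ZMod p) (M : Fin n → Fin n → ZMod p) (b : Fin n → ZMod p)
    (H : (Fin k → ZMod p) → ZMod p → Bool)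
    (hy₀ : ∀ u, y g₀ u = H (fun j => ∑ i, if u i = true then Λ j i else 0) (quadVal M b u))
    (C : ℝ) (hC : 0 ≤ C)
    (hBR : ∀ (n : ℕ) (A : Finset (Fin n → ZMod p)) (α : ℝ), 0 < α → α ≤ 1 → α * (p : ℝ) ^ n ≤ A.card →
      ∃ V : Submodule (ZMod p) (Fin n → ZMod p),
        ((n : ℝ) - finrank (ZMod p) V) ≤ C * (1 + Real.log (1 / α)) ^ 4 ∧
        ∀ v ∈ V, ∃ a₁ ∈ A, ∃ a₂ ∈ A, ∃ a₃ ∈ A, ∃ a₄ ∈ A, v = a₁ + a₂ - a₃ - a₄)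
    (w w₂ r h L r₀ t N f t' : ℕ)
    (hw : 4 * p ^ 2 * (3 + (r + k + 1) * p) + r ≤ w) (hw₂ : 4 * p ^ 2 * (6 + 2 * (r + k + 1) * p) ≤ w₂)
    (hn : k * w + w + r + (2 * p - 1) * t + (p - 1) * N + 1 ≤ n)
    (hr₀a : 648 * p ^ (2 * (r + k + 1)) ≤ 4 ^ r₀) (hL : 1296 * p ^ (2 * (r + k + 1)) * (n * p + 1) ^ w₂ ≤ p ^ L)
    (hr₀ : 8 * h + ⌊C * (1 + L * Real.log p) ^ 4⌋₊ ≤ r₀) (hh : 2 * p ^ 2 * (L * p) ≤ h + 1)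
    (ht : (n + 1) * (p ^ (k + (6 * r₀ + 1)) * 2) < 2 ^ t)
    (hcountB : 3 * p ^ k * p ^ k * ((n + 1) * (p ^ k * 2) + 1) < 2 ^ r)
    (hN : w * (f * f) + 2 ≤ N) (hf : (2 * p - 1) * t' ≤ f) (ht' : (n + 1) * (p ^ (k + (2 * (r + k) + 1)) * 2) < 2 ^ t') :
    ∃ u, ringWinU c y u = false := by
  classical
  have hp1 : 1 ≤ p := by omega
  -- (S1) label preparation at threshold `w`
  obtain ⟨U₀, -, hU₀card, hprep⟩ := puncture_from Λ w k ∅ (by simp)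
  simp only [card_empty, zero_add] at hU₀card
  -- (S2) the pool region
  set B₀ : Finset (Fin n) := U₀ᶜ with hB₀
  have hB₀card : B₀.card = n - U₀.card := by rw [hB₀, card_compl, Fintype.card_fin]
  have hU₀n : U₀.card ≤ n := (card_le_univ U₀).trans_eq (Fintype.card_fin n)
  -- (S3) kernel Y's dichotomy for the single pencil member `M + Mᵀ`, weights on `B₀`, threshold `w`, target size `r`
  set S : Fin 1 → Fin n → Fin n → ZMod p := fun _ i l => M i l + M l i with hS
  rcases JointFreeness.free_dichotomy S Λ B₀ w B₀ r with ⟨I, hIB, hIfree, hIcard⟩ | ⟨I, hIB, hIfree, hIlt, hstr⟩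
  · ------------------------------------------------------------------ FREE branch
    set e : Fin r ↪ Fin n := (I.orderEmbOfFin hIcard).toEmbedding with he
    set B : Finset (Fin n) := B₀ \ I with hB
    set T : Fin B.card ↪ Fin n := (B.orderEmbOfFin rfl).toEmbedding with hT
    have hBcard : B.card = B₀.card - r := by rw [hB, card_sdiff_of_subset hIB, hIcard]
    have heI : ∀ j, e j ∈ I := fun j => orderEmbOfFin_mem I hIcard j
    have hTBmem : ∀ i, T i ∈ B := fun i => orderEmbOfFin_mem B rfl i
    have heT : ∀ j i, e j ≠ T i := by
      intro j i hji
      have h1 := hTBmem i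
      rw [← hji, hB, mem_sdiff] at h1
      exact h1.2 (heI j)
    have hTB : ∀ l, l ∈ B ↔ ∃ i, T i = l := by
      intro l
      constructor
      · intro hl
        have : l ∈ Set.range (B.orderEmbOfFin rfl) := by rw [range_orderEmbOfFin]; exact hl
        obtain ⟨i, hi⟩ := this
        exact ⟨i, hi⟩
      · rintro ⟨i, rfl⟩
        exact hTBmem i
    have hBU : ∀ l ∈ B, l ∉ U₀ := by
      intro l hl
      rw [hB, mem_sdiff, hB₀, mem_compl] at hl
      exact hl.1
    have hcorrset : (univ.filter fun i : Fin n => i ∉ U₀ ∧ i ∉ B) = I := by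
      ext i
      rw [mem_filter, hB, mem_sdiff, hB₀, mem_compl]
      constructor
      · rintro ⟨-, hi1, hi2⟩
        by_contra hiI
        exact hi2 ⟨hi1, hiI⟩
      · intro hiI
        have hiB₀ := hIB hiI
        rw [hB₀, mem_compl] at hiB₀
        exact ⟨mem_univ _, hiB₀, fun h => h.2 hiI⟩
    have hcorr : (w - r) + (univ.filter fun i : Fin n => i ∉ U₀ ∧ i ∉ B).card ≤ w := by
      rw [hcorrset, hIcard]; omega
    have hFree' : JointFreeness.Free (fun (_ : Fin 1) i l => M i l + M l i) Λ B (w - r) (univ.map e) := by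
      rw [he, map_orderEmbOfFin_univ, hB, ← hIcard]
      exact free_sdiff S Λ B₀ w I hIfree
    have hwm : w - r ≤ B.card := by rw [hBcard, hB₀card]; omega
    have hm : (2 * p - 1) * t ≤ B.card := by rw [hBcard, hB₀card]; omega
    -- side thresholds
    set D : ℕ := 324 * p ^ (2 * (r + k + 1)) with hD
    have hDpos : 0 < D := by rw [hD]; positivity
    refine loss_of_Free_dichotomy hp5 hp3 c y g₀ lam F hF Λ M b H hy₀ U₀ w hprep e T heT B hTB hBU (w - r) hwm hcorr hFree'
      w₂ (by omega) hw₂ C hC hBR h L r₀ (fun side => 4 ^ Fintype.card (Side₁ side) / D) hr₀ hh ?_ t hm ht hcountB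
    intro side
    by_cases htiny : Fintype.card (Side₁ side) ≤ r₀
    · exact Or.inl htiny
    right
    have hx : 2 * D ≤ 4 ^ Fintype.card (Side₁ side) :=
      calc 2 * D = 648 * p ^ (2 * (r + k + 1)) := by rw [hD]; ring
        _ ≤ 4 ^ r₀ := hr₀a
        _ ≤ 4 ^ Fintype.card (Side₁ side) := Nat.pow_le_pow_right (by norm_num) (by omega)
    have hK₂ : Fintype.card (Side₂ side) ≤ n := by
      have h1 := card_sides side
      have h2 : B.card ≤ n := (card_le_univ B).trans_eq (Fintype.card_fin n)
      omega
    have hP : 4 * D * (Fintype.card (Side₂ side) * p + 1) ^ w₂ ≤ p ^ L :=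
      calc 4 * D * (Fintype.card (Side₂ side) * p + 1) ^ w₂
          ≤ 4 * D * (n * p + 1) ^ w₂ :=
            Nat.mul_le_mul_left _ (Nat.pow_le_pow_left (by nlinarith) _)
        _ = 1296 * p ^ (2 * (r + k + 1)) * (n * p + 1) ^ w₂ := by rw [hD]; ring
        _ ≤ p ^ L := hL
    obtain ⟨h1, h2, h3⟩ := side_threshold hDpos hx hP
    exact ⟨h1, h2, h3⟩
  · ------------------------------------------------------------------ STRUCTURED branch
    set Dstr : Finset (Fin n) := B₀ \ I with hDstr
    have hDcard : Dstr.card = B₀.card - I.card := by rw [hDstr, card_sdiff_of_subset hIB]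
    have hθex : ∀ j, ∃ θ : Fin 1 → ZMod p, j ∈ Dstr → (θ ≠ 0 ∧ JointFreeness.StructDir S Λ B₀ w I j θ) := by
      intro j
      by_cases hj : j ∈ Dstr
      · rw [hDstr, mem_sdiff] at hj
        obtain ⟨θ, hθ⟩ := hstr j hj.1 hj.2
        exact ⟨θ, fun _ => hθ⟩
      · exact ⟨fun _ => 1, fun h => absurd h hj⟩
    choose θ hθ using hθex
    have hDne : Dstr.Nonempty := by
      rw [← card_pos, hDcard, hB₀card]; omega
    have hNcard : (Fintype.card (ZMod p) ^ 1 - 1) * N ≤ Dstr.card := by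
      rw [ZMod.card, pow_one, hDcard, hB₀card]; omega
    obtain ⟨θ₀, hθ₀ne, hJcard⟩ :=
      JointFreeness.exists_popular_direction Dstr θ (fun j hj => (hθ j hj).1) N hNcard hDne
    set J : Finset (Fin n) := Dstr.filter (fun j => θ j = θ₀) with hJ
    have hJB : J ⊆ B₀ := (filter_subset _ _).trans sdiff_subset
    obtain ⟨cc, cc', s, hsupp, hlight, hid⟩ := JointFreeness.structured_family S Λ B₀ w I J θ₀ (fun j hj => by
      rw [hJ, mem_filter] at hj
      have h2 := (hθ j hj.1).2
      rw [hj.2] at h2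
      exact h2)
    -- a pair-free `f`-sub-pool of the direction class
    have hw1 : 1 ≤ w := by
      have : 0 < 4 * p ^ 2 * (3 + (r + k + 1) * p) := by positivity
      omega
    have hfJ : f ≤ J.card := by
      have h1 : f ≤ w * (f * f) := (Nat.le_mul_self f).trans (Nat.le_mul_of_pos_left _ hw1)
      omega
    have h2f : 2 ≤ f := by
      have h1 : 1 ≤ t' := by
        rcases Nat.eq_zero_or_pos t' with h0 | h0
        · rw [h0, pow_zero] at ht'
          have : 0 < (n + 1) * (p ^ (k + (2 * (r + k) + 1)) * 2) := by positivity
          omega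
        · exact h0
      have : (2 * p - 1) * 1 ≤ (2 * p - 1) * t' := Nat.mul_le_mul_left _ h1
      omega
    have hdeg : ∀ j ∈ J, (J.filter fun l => l ≠ j ∧ s j l ≠ 0).card ≤ w - 1 := fun j hj =>
      Nat.le_sub_one_of_lt (JointFreeness.inClass_weight_lt J s hJB (hlight j hj))
    have hsumc : ∑ j ∈ J, (w - 1) = J.card * (w - 1) := by rw [sum_const, smul_eq_mul]
    have hbad : (JointFreeness.badPairs J s).card ≤ J.card * (w - 1) :=
      (JointFreeness.card_badPairs_le J s).trans ((sum_le_sum hdeg).trans hsumc.le)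
    obtain ⟨Fs, hFsJ, hFscard, hpf⟩ := JointFreeness.exists_pairFree J s f
      (pairFree_count h2f hfJ hbad (hN.trans hJcard))
    set T : Fin f ↪ Fin n := (Fs.orderEmbOfFin hFscard).toEmbedding with hT
    have hTJ : ∀ a, T a ∈ J := fun a => hFsJ (orderEmbOfFin_mem Fs hFscard a)
    set eI := I.orderEmbOfFin rfl with heI
    have hθ0 : θ₀ 0 ≠ 0 := by
      intro h0
      apply hθ₀ne
      funext i
      rw [Subsingleton.elim i 0, h0]
      rfl
    have hrow : ∀ a b, θ₀ 0 * (M (T a) (T b) + M (T b) (T a))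
        = (∑ x, cc (T a) 0 (eI x) * (M (eI x) (T b) + M (T b) (eI x))) + (∑ q, cc' (T a) q * Λ q (T b))
          + s (T a) (T b) := by
      intro a b
      have h1 := hid (T a) (hTJ a) (T b)
      simp only [hS, Fin.sum_univ_one] at h1
      rw [sum_of_suppIn (fun i => cc (T a) 0 i * (M i (T b) + M (T b) i)) I rfl
        (fun i hi => by rw [(hsupp (T a) (hTJ a)) 0 i hi, zero_mul])] at h1
      exact h1
    have hpair : ∀ a b, a ≠ b → s (T a) (T b) = 0 := fun a b hab =>
      hpf (T a) (orderEmbOfFin_mem Fs hFscard a) (T b) (orderEmbOfFin_mem Fs hFscard b)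
        (fun h => hab (T.injective h).symm)
    have ht'' : (n + 1) * (p ^ (k + (2 * (I.card + k) + 1)) * 2) < 2 ^ t' := by
      have : p ^ (k + (2 * (I.card + k) + 1)) ≤ p ^ (k + (2 * (r + k) + 1)) :=
        Nat.pow_le_pow_right hp1 (by omega)
      calc (n + 1) * (p ^ (k + (2 * (I.card + k) + 1)) * 2) ≤ (n + 1) * (p ^ (k + (2 * (r + k) + 1)) * 2) :=
            Nat.mul_le_mul_left _ (Nat.mul_le_mul_right _ this)
        _ < 2 ^ t' := ht'
    obtain ⟨v, hv⟩ := loss_of_structuredPool hp5 c y g₀ lam F hF Λ M b H hy₀ (fun _ => false) T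
      (fun x => eI x) (fun a x => cc (T a) 0 (eI x)) (fun a => cc' (T a)) (fun a => s (T a)) (θ₀ 0) hθ0 hrow hpair
      (DisperseArithmetic.hcountA_of hp1 hf ht'')
    exact ⟨_, hv⟩

end Summit.QuantumAdvantage.QuantumAdvantage.Theorems.ColumnBridge
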